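import Summits.MatrixMultiplication.MatrixMultiplication.Theses.AlgebraicSTPPDichotomy
import Literature.Barriers.MatrixMultiplication.BoundedRankFrameBarrier

/-!
# Refutation of the route target `ExactFrameDesign` (AlgebraicSTPPDichotomy, stmt-MatrixMultiplication-9721)

The dichotomy is decided on its NEGATIVE side: the bounded-rank frame barrier
(`Literature.Barriers.MatrixMultiplication.BoundedRankFrameBarrier`, proved in the tree) is literally
`FrameBarrier`, and `FrameBarrier ↔ ¬ ExactFrameDesign` (route item FrameBarrierIffNotExact). This
file is the refuter's one theorem `¬ ExactFrameDesign`; the positive closes (FrameBarrier,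
AlgebraicFrameBarrier, LineFrameBarrier, FrameToLine) are one-liners for a prover over the same
catalogue theorem.
-/

/-- Refutes `AlgebraicSTPPDichotomy.ExactFrameDesign` [refuted-substantive]: there is NO
dimension-exact STPP design of punctured-subspace frames in any bounded rank — every STPP frame
family in `F_q^m`, `q ≥ 81`, obeys `Σ_i (|A_i||B_i||C_i|)^{(2+ε_m)/3} ≤ q^m` with `ε_m = 2/(6m+5)`
(the bounded-rank frame barrier `Literature.Barriers.MatrixMultiplication.BoundedRankFrameBarrier`,
proved: richness lemma + second moment over independent vector pairs give a packing defect of a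
full factor `≈ q/9` in one of the three pairings, then BCCGNSU Lemma 2.4 effective). Witness-free
(a theorem for every `m`); no cheap repair: the defect is a power of `q`, so neither a
normalisation, nor a larger `q₀`, nor a smaller `ε`, nor restricting to lines / polynomial families
rescues the design (those are the items LineFrameBarrier / AlgebraicFrameBarrier, which HOLD);
barrier-candidate: landed as `BoundedRankFrameBarrier` (D-0021 catalogue). [folklore] -/
theorem AlgebraicSTPPDichotomyExactFrameDesign_refuted :
    ¬ Summit.MatrixMultiplication.MatrixMultiplication.Theses.AlgebraicSTPPDichotomy.ExactFrameDesign := by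
  rintro ⟨m, h⟩
  obtain ⟨ε, hε, q₀, hb⟩ :=
    Literature.Barriers.MatrixMultiplication.boundedRankFrameBarrier_holds m
  obtain ⟨F, _, _, hq, N, V, W, U, A, B, C, hA, hB, hC, hS, hlt⟩ := h ε hε q₀
  exact absurd (hb F hq N V W U A B C hA hB hC hS) (not_le.2 hlt)
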